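import Mathlib
import HarnessLib
import Summits.HubbardSuperconductivity.HubbardSuperconductivity.Theorems.KLProgrammeKLRegimeEngineV8PairTransferExport4
import Summits.HubbardSuperconductivity.HubbardSuperconductivity.Theorems.KLProgrammeKLRegimeEngineV8PairTransferRelBarF
import Summits.HubbardSuperconductivity.HubbardSuperconductivity.Theorems.KLProgrammeKLRegimeEngineV8PairTransferRelDefsCB
import Summits.HubbardSuperconductivity.HubbardSuperconductivity.Theorems.KLProgrammeKLRegimeEngineV8PairTransferRelBarIdx

/-!
# Route `KLProgramme` — ENGINE child gen 8 (stmt-HubbardSuperconductivity-20437 `KLRegimeEngineV17F2`), skeleton-v2 export class #5 «(S)-transfer», TEXT REV 3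
# names-only LAYER «Export5» (plan g20 (R54t)/(R54u)/(R54v)): the keyed relative family RE-KEYED to the RESTRICTED symbol family and the bar OF RECORD
# `transferBarRelAtF`, + exactly the decls whose bodies change with it (cell gate-hubbard-kl, seat p1b g13 = 20437 registrant; `…PairTransferExport4` p586948 STANDS
# and is imported — `IsTransferPkg4` and every bookkeeping lemma whose body does not mention the family are REUSED from it; the restricted family
# vocabulary is p1 g13's PICK «cutoff-built» in INDEX form (members `softSymbolCompl … n m`; symbol-level twin `…PairTransferRelDefsCB` p588716), the bar `transferBarRelIdx` is p1 g13's
# `…PairTransferRelBarIdx` (k3c1-p1's `transferBarRelAtWF` p586991 at index-determined weights) — untouched)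

WHY A LAYER ON TOP OF Export4.  Two STATEMENT-LEVEL points decided after Export4 landed (23:48Z 08-27): (R54t) the WIDE family `PairTransferRelFamily … n TB` (all
`IsSoftSymbol` pairs in hypothesis AND conclusion) is not reachable by the planned induction — an arbitrary admissible pair at `n` has no admissible history pair at
`n − 1` to key `pairTransferRelAt_succ` (p586440) to (p1 g12 «(F)-MASS» sharpening) — so the family is RESTRICTED to a step-closed, consumer-complete, frame-covariant
sub-family — p1's PICK (23:58:35Z 08-27): the CUTOFF-BUILT (complementary) members `IsCutoffBuilt … K n ψ := ∃ m ≥ n, ψ = s^K_{n,m}`,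
step-closed by `s^K_{n+1,m} + s^K_{n,n+1} = s^K_{n,m}`, consumer-complete (step 3 reads `(s_{n,n+1} | 0)` only); (R54u) the bar OF RECORD is k3c1-p1's `transferBarRelAtF` (RelBarF: born-overlap FLOOR slot re-weighted `ov ↦ (4ⁿ)⁻¹·ov`, the only floor the consumer's
`transferBarAt` can host; floor recount for RADIAL symbols).  Def bodies freeze 08-29, `Theorems/` is append-only, and Export4's wrapper body keys the wide family at
`transferBarRelAt`; hence (R54v)(2): a names-only layer with NEW names exactly where a body changes —

* §1 (bar = p1 g13's `transferBarRelIdx L G P r β U n m′`, `…PairTransferRelBarIdx`: `transferBarRelAtWF` at the uniform mass `15367·4^{−(m′−n)}`, uniform overlap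
  `15367·[m′ = n]`, slack prefactor `r·(2 − 2^{−n})` — the «(F)-MASS-KEY» amendment: induction hypothesis and conclusion carry the SAME frame-free weights, inheritance is
  exact arithmetic (`transferBarRelIdx_succ_room`), (F)(iii) vanishes) **`PairTransferRelFamilyK5 L M G P r β U μ n := ∀ m m′, n ≤ m′ → m′ ≤ m → m ≤ nScales β + 1 → PairTransferRelAt … n
  (transferBarRelIdx … n m′) s_{n,m} s_{n,m′}`** (pinned family's arity; no idle binder), and the per-member bridge
  `PairTransferRelFamilyK5.pinnedAt` (pinned pair `(s_{n,m} | 0)`, ONE hosting inequality ⇒ rev 2's `PairTransferPinnedAt … r′ … n s_{n,m}`, = p1's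
  `pairTransferPinnedAt_compl_of_relIdx_of_le` — all step 3 p581707 consumes);
* §2 **`PairTransferStep5 P R Q₀ r u`** (= `PairTransferStep5` with the keyed family `…K5` in history and conclusion; binder list BYTE-VERBATIM), the deferred package
  `klTransferPkg5 / klCT5 / klCTu5` (their bodies reference `PairTransferStep5`; admissibility predicate `IsTransferPkg4` REUSED), `isTransferPkg4_klTransferPkg5`,
  `klCT5_nonneg`, `klCTu5_pos`, `pairTransferStep5_klCT5_of_exists/_of`;
* §3 **`pairTransferRelFamilyK5_all_of_step5`** — the unroll (argument list = `pairTransferRelFamilyK5_all_of_step5`'s verbatim).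
Render tokens (rev 8 da8692658bbb27b4 → rev 8′/9, (X).3 / (c) / §C / §P3): `PairTransferStep5 ↦ PairTransferStep5`, `PairTransferRelFamilyK5 ↦ PairTransferRelFamilyK5`,
`klCT5 ↦ klCT5`, `klCTu5 ↦ klCTu5`, `pairTransferStep5_klCT5_of_exists ↦ pairTransferStep5_klCT5_of_exists`, `pairTransferRelFamilyK5_all_of_step5 ↦
pairTransferRelFamilyK5_all_of_step5`; `IsTransferPkg4` unchanged; DefsU11's class-#5 row reads `klCTu5 P R (klEngQ7 P R) (klEngQ9c P R) cc`.
Definitions with bodies + bookkeeping; nothing about the model is asserted (the relative clauses are the class-#5 producer's obligation, stub (X).3); nothing asserts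
any stub of 20437, K3 or superconductivity.  0 kit · 0 lit.
-/

noncomputable section

namespace Summit.HubbardSuperconductivity.HubbardSuperconductivity.Theorems.EngineV8

set_option linter.dupNamespace false -- summit = problem name (single-conjunct summit), D-0017

open Real Finset Literature.MathematicalPhysics.QuantumLattice Literature.Probability.LatticeModels
open Literature.MathematicalPhysics.QuantumLattice.FermiRG
open Summit.HubbardSuperconductivity.HubbardSuperconductivity.Theorems.KLProgrammeLegKernels
open Summit.HubbardSuperconductivity.HubbardSuperconductivity.Theorems.DispersionFlow
open Summit.HubbardSuperconductivity.HubbardSuperconductivity.Theorems.KLRegimeSplit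

/-! ## §1 The keyed relative family — INDEX-KEYED bar (p1 g13's «(F)-MASS-KEY» amendment) — and its bridge to rev 2 -/

section Keyed

variable (L M : ℕ) [NeZero L] [NeZero M]

/-- **`PairTransferRelFamilyK5 L M G P r β U μ n`** — class #5 rev 3's invariant in the PINNED FAMILY'S ARITY (names-only layer Export5, pen (R54v)/(R54x)), INDEX form of
p1 g13's PICK «cutoff-built»: for every ordered pair of complementary members `(s^{Kₙ}_{n,m} | s^{Kₙ}_{n,m′})`, `n ≤ m′ ≤ m ≤ nScales β + 1`, the relative clause
`PairTransferRelAt … n` (p585429) with p1 g13's INDEX-KEYED bar `transferBarRelIdx L G P r β U n m′` (`…PairTransferRelBarIdx`: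
`transferBarRelAtWF` p586991 at `klIdxPrefactor r n = r·(2 − 2^{−n})`, `klIdxMass n m′ = 15367·4^{−(m′−n)}`, `klIdxOverlap n m′ = 15367·[m′ = n]`). -/
def PairTransferRelFamilyK5 (G : GeoConsts) (P : SplitConsts) (r β U μ : ℝ) (n : ℕ) : Prop :=
  ∀ m m' : ℕ, n ≤ m' → m' ≤ m → m ≤ nScales β + 1 →
    PairTransferRelAt L M β U μ n (transferBarRelIdx L G P r β U n m')
      (softSymbolCompl L M β μ (klFlowFrameU L M β U μ n) n m) (softSymbolCompl L M β μ (klFlowFrameU L M β U μ n) n m')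

variable {L M}

/-- **BRIDGE to rev 2, per member**: the pinned pair `(s_{n,m} | s_{n,n})`, `s_{n,n} = 0` (`softSymbolCompl_self`), gives rev 2's
`PairTransferPinnedAt L M G′ P r′ β U μ n (s^{Kₙ}_{n,m})` once the `m′ = n` bar is hosted by `transferBarAt L G′ P r′ … n` (any target package `G′`) — all that step 3
(`pairLadderStepAtV17F2_of_pairTransferPinnedAt`, p581707) consumes (it reads `m := n + 1`); = p1's `pairTransferPinnedAt_compl_of_relIdx_of_le` (`…PairTransferRelBarIdx`) at the family's pair `(m, m′ := n)`. -/
theorem PairTransferRelFamilyK5.pinnedAt {G G' : GeoConsts} {P : SplitConsts} {r r' β U μ : ℝ} {n : ℕ} (h : PairTransferRelFamilyK5 L M G P r β U μ n)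
    {m : ℕ} (hnm : n ≤ m) (hm : m ≤ nScales β + 1)
    (hle : ∀ Qm k k', transferBarRelIdx L G P r β U n n Qm k k' ≤ transferBarAt L G' P r' β U n Qm k k') :
    PairTransferPinnedAt L M G' P r' β U μ n (softSymbolCompl L M β μ (klFlowFrameU L M β U μ n) n m) :=
  pairTransferPinnedAt_compl_of_relIdx_of_le (h m n le_rfl hnm hm) hle

end Keyed

/-! ## §2 The v2-composable step, the admissible packages, the deferred package -/

/-- **`PairTransferStep5 P R Q₀ r u`** — class #5's induction step, rev 3 / Export5, in the v2-COMPOSABLE shape: `PairTransferStep4`'s (= `…Step3`'s) binder list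
BYTE-VERBATIM (every geometry
package `G` (`G.WF`), every RAISE `Q` of the key package `Q₀`, `0 < cc ≤ klEngC₃6 P R`, `μ ∈ klWindowC`, `0 < U ≤ klEngU₀10 P R cc`, the step's own threshold
`U ≤ u Q cc`, `klBetaMin ≤ β ≤ e^{cc/U²}`, `klEngL₄ P R β U ≤ L`, `klEngM₃ β U L ≤ M`, `n ≤ nScales β + 1`, `IsKLRegime`, the public history AT `Q`, the admissibility
of `Kₙ`, the class-#1 MERGED exports at every `j ≤ n`) with the KEYED RESTRICTED RELATIVE families `…K5` at every `j < n` as history and at `n` as conclusion.  Inside the producer the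
pair `(ψ₁ | ψ₂)` at `n` comes from `(ψ₁ + sₙ | ψ₂ + sₙ)` at `n − 1` with the SAME difference, so the inherited allowance carries the factor `1/4` (`klSoftMass_succ`). -/
def PairTransferStep5 (P : SplitConsts) (R : RenConsts) (Q₀ : EngConsts) (r : ℝ) (u : EngConsts → ℝ → ℝ) : Prop :=
  ∀ G : GeoConsts, G.WF → ∀ Q : EngConsts, Q₀.IsRaiseOf Q →
    ∀ cc : ℝ, 0 < cc → cc ≤ klEngC₃6 P R →
      ∀ μ ∈ klWindowC, ∀ U : ℝ, 0 < U → U ≤ klEngU₀10 P R cc → U ≤ u Q cc →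
        ∀ β : ℝ, klBetaMin ≤ β → β ≤ Real.exp (cc / U ^ 2) →
          ∀ (L M : ℕ) [NeZero L] [NeZero M], klEngL₄ P R β U ≤ L → klEngM₃ β U L ≤ M →
            ∀ n : ℕ, n ≤ nScales β + 1 → IsKLRegime U cc (-(n : ℤ)) →
              HistP klPredsV17F2 L M G P Q R β U μ 0 n →
                FrameOK R U (nScales β) μ (klFlowFrameU L M β U μ n) →
                  (∀ j ≤ n, LevelsUExportMixedAt L M (klCU2 P R Q₀) P β U μ j) →
                    (∀ j < n, PairTransferRelFamilyK5 L M G P r β U μ j) →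
                      PairTransferRelFamilyK5 L M G P r β U μ n

section Deferred

variable (P : SplitConsts) (R : RenConsts) (Q₀ : EngConsts)

/-- **The deferred transfer package, rev 3 / Export5**: SOME admissible (`IsTransferPkg4`, reused) `(r, u)` for which `PairTransferStep5 P R Q₀ r u` holds, if one exists, else the trivial package. -/
def klTransferPkg5 : ℝ × (EngConsts → ℝ → ℝ) :=
  open scoped Classical in
  if h : ∃ e : ℝ × (EngConsts → ℝ → ℝ), IsTransferPkg4 e ∧ PairTransferStep5 P R Q₀ e.1 e.2 then Classical.choose h else (0, fun _ _ => 1)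

/-- **The deferred transfer constant `klCT5 P R Q₀`** — a closed term today, adequate the day the class-#5 producer proves `PairTransferStep5 P R Q₀ r u` for an
admissible package (`pairTransferStep5_klCT5_of_exists`; stub (X).3 of 20437 v2 rev 8′/9). -/
def klCT5 : ℝ := (klTransferPkg5 P R Q₀).1

/-- **The deferred coupling threshold `klCTu5 P R Q₀ : EngConsts → ℝ → ℝ`** (DefsU11's class-#5 row reads it at `(klEngQ9c P R, cc)` under rev 8′/9). -/
def klCTu5 : EngConsts → ℝ → ℝ := (klTransferPkg5 P R Q₀).2

/-- The deferred package is admissible (unconditionally). -/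
theorem isTransferPkg4_klTransferPkg5 : IsTransferPkg4 (klTransferPkg5 P R Q₀) := by
  classical
  unfold klTransferPkg5
  split_ifs with h
  · exact (Classical.choose_spec h).1
  · exact isTransferPkg4_zero

/-- `0 ≤ klCT5 P R Q₀` (unconditionally). -/
theorem klCT5_nonneg : 0 ≤ klCT5 P R Q₀ := (isTransferPkg4_klTransferPkg5 P R Q₀).1

/-- `0 < klCTu5 P R Q₀ Q cc` (unconditionally) — so a `min` with it keeps the engine's U-door positive. -/
theorem klCTu5_pos (Q : EngConsts) (cc : ℝ) : 0 < klCTu5 P R Q₀ Q cc := (isTransferPkg4_klTransferPkg5 P R Q₀).2 Q cc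

variable {P R Q₀}

/-- **The step holds for the deferred package as soon as it holds for some admissible package** (how §C reads (X).3). -/
theorem pairTransferStep5_klCT5_of_exists (h : ∃ e : ℝ × (EngConsts → ℝ → ℝ), IsTransferPkg4 e ∧ PairTransferStep5 P R Q₀ e.1 e.2) :
    PairTransferStep5 P R Q₀ (klCT5 P R Q₀) (klCTu5 P R Q₀) := by
  classical
  have hpkg : klTransferPkg5 P R Q₀ = Classical.choose h := by
    unfold klTransferPkg5
    rw [dif_pos h]
  unfold klCT5 klCTu5
  rw [hpkg]
  exact (Classical.choose_spec h).2

/-- Packaging an explicit witness. -/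
theorem pairTransferStep5_klCT5_of {r : ℝ} {u : EngConsts → ℝ → ℝ} (hr : 0 ≤ r) (hu : ∀ Q cc, 0 < u Q cc) (hs : PairTransferStep5 P R Q₀ r u) :
    PairTransferStep5 P R Q₀ (klCT5 P R Q₀) (klCTu5 P R Q₀) :=
  pairTransferStep5_klCT5_of_exists ⟨(r, u), ⟨hr, hu⟩, hs⟩

end Deferred

/-! ## §3 The unroll (the term §C's `htr` line calls) -/

section Unroll

variable {P : SplitConsts} {R : RenConsts} {Q₀ Q : EngConsts} {G : GeoConsts} {cc μ U β : ℝ} {L M : ℕ} [NeZero L] [NeZero M]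

/-- **CLASS #5 UNROLLED, rev 3 / Export5**: from `PairTransferStep5 P R Q₀ r u`, a geometry package `G` (`G.WF`), a raise `Q` of `Q₀`, the v2 binders, the bare frame's
admissibility `h0`, `R.WF2`, the public history up to `n ≤ n_β + 1` AT `Q` and the class-#1 merged exports at every `j ≤ n`: the keyed restricted relative family at EVERY
`j ≤ n` (argument list = `pairTransferRelFamilyK_all_of_step4`'s verbatim). -/
theorem pairTransferRelFamilyK5_all_of_step5 {r : ℝ} {u : EngConsts → ℝ → ℝ} (hstep : PairTransferStep5 P R Q₀ r u) (hG : G.WF) (hQ : Q₀.IsRaiseOf Q)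
    (hcc0 : 0 < cc) (hcc : cc ≤ klEngC₃6 P R) (hμ : μ ∈ klWindowC) (h0 : FrameOK R U (nScales β) μ 0) (hU : 0 < U) (hU10 : U ≤ klEngU₀10 P R cc)
    (hUu : U ≤ u Q cc) (hβ : klBetaMin ≤ β) (hβc : β ≤ Real.exp (cc / U ^ 2)) (hL : klEngL₄ P R β U ≤ L) (hM : klEngM₃ β U L ≤ M) (hR : R.WF2)
    {n : ℕ} (hn : n ≤ nScales β + 1) (hhist : HistP klPredsV17F2 L M G P Q R β U μ 0 n)
    (hlev : ∀ j ≤ n, LevelsUExportMixedAt L M (klCU2 P R Q₀) P β U μ j) : ∀ j ≤ n, PairTransferRelFamilyK5 L M G P r β U μ j :=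
  exports_all_of_step₂ (E := fun j => LevelsUExportMixedAt L M (klCU2 P R Q₀) P β U μ j) (F := fun j => PairTransferRelFamilyK5 L M G P r β U μ j) (N := n)
    hlev
    (fun m hm hE hist => by
      have hmn : m ≤ nScales β + 1 := hm.trans hn
      have hhm : HistP klPredsV17F2 L M G P Q R β U μ 0 m := histP_klPredsV17F2_of_le hhist hm
      exact hstep G hG Q hQ cc hcc0 hcc μ hμ U hU hU10 hUu β hβ hβc L M hL hM m hmn (isKLRegime_of_le_nScales_succ hcc0.le hβ hβc hmn) hhm
        (frameOK_klFlowFrameU_of_histP hR h0 hmn hhm) hE hist)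
    n le_rfl

end Unroll

end Summit.HubbardSuperconductivity.HubbardSuperconductivity.Theorems.EngineV8

end
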